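import Mathlib
import Summits.MatrixMultiplication.MatrixMultiplication.Theses.ThinBlockAlpha
import Summits.MatrixMultiplication.MatrixMultiplication.Theses.GroupTheoreticSTPP
import Summits.MatrixMultiplication.MatrixMultiplication.Theses.CwPowerHosting
import Summits.MatrixMultiplication.MatrixMultiplication.Theorems.ThinPackings.Negative.ThinPackingsIffCThesis

/-!
# Line `cw2-free-hosting` — crux `ThinBlockAlpha.ThinPackings` (stmt-MatrixMultiplication-10595)

Crux-strategist line (wall-breaker gen 3, planner-cstrat-stmt-MatrixMultiplication-10595-p3-0, 2026-08-17).
Card: `Lines/cw2-free-hosting.md`.  Namespace `…Cruxes.ThinPackings.Cw2FreeHosting`.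

THE DOOR.  Every construction line on this crux so far manufactures abelian STPP families from a TEMPLATE (USP / chart /
laser zero-out / carry chart / stacked window) plus a TYPED EXTRACTION (hashing).  The gen-3 census (STRATEGY-CENSUS.md,
§N15–N17) closes the last located reservoir of extra entropy inside that technology (the non-Latin "onion" mixing of the
truncated-convolution tensors: Bollobás's set-pair inequality confiscates it exactly).  This line records the ONE
in-tree statement outside that technology which still implies the crux: a FREE ADDITIVE HOSTING of the support of the
Kronecker powers of the `S₃` permutation tensor `xyz` (= the small Coppersmith–Winograd tensor `T_cw,2` over `ℂ`) in
finite abelian groups at rate three — route `CwPowerHosting`'s crux `HostingRateThree` (stmt-MatrixMultiplication-15970):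
for every `ε > 0` some `N ≥ 1`, a finite abelian `H` with `|H| ≤ 3^{(1+ε)N}` and maps `α β γ : ({0,1,2}^N) → H` with
`α x + β y + γ z = 0 ↔ ∀ i, x i, y i, z i pairwise distinct`.  Such a hosting is NOT coordinatewise (product hosts are
stuck at `4^N`, AVW 2018 §6; the first open rung is `BeatFour`, `g(3) ∈ [54, 63]`), so it is not a template design,
and its decidable rungs, floors (`3^{N-1}(N+3)`) and expected kill (`HostingCapacityGap`) live on that route.

THE MECHANISM (why a hosting gives DESIGNS, not just rank).  `xyz` has the simple-CW block structure: with levels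
`0 ↦ 0`, `1,2 ↦ 1` the supported level patterns are exactly `{011, 101, 110}` (tight: labels `(-2, 1)` on each leg),
and the block of a supported level triple `(I, J, K)` of words is the matrix-product incidence
`⟨2^{n₁₀₁}, 2^{n₁₁₀}, 2^{n₀₁₁}⟩` (on a `110`-coordinate `y_t = 3 - x_t`, etc.).  The tree's hashing theorem
(`LaserMethodTypeCount.exists_free_diagonal_jointType_card`, PROVED) gives a FREE DIAGONAL `Δ` of balanced level triples of
size `(27/4)^{M/3} · 2^{-o(M)}` (`stub_levelDiagonal`); powering the hosting `k` times and restricting to the blocks of `Δ`,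
QUASI-UNIQUENESS of matrix-product sub-supports of an addition table (fix `k₀`, solve the cocycle identity:
`α(x(i,j)) = t_j - s_i`, `β(y(j,k)) = u_k - t_j`, `γ(z(k,i)) = s_i - u_k`) turns every block into an honest TPP triple
`(A_δ, B_δ, C_δ)` and the free diagonal + the hosting's `↔` into the SIMULTANEOUS TPP (`stub_hostedExtraction`).  The
packing sum is `|Δ| · (2^M)^{(2+ε)/3} = 3^M · 2^{M(ε/3 - ε₂)}` against `|H^k| ≤ 3^{(1+ε₁)M}`: rate three is EXACTLY the
CThesis threshold (`(27/4)^{1/3} · 4^{1/3} = 3`), so `HostingRateThree ⇒ CThesis ⇒ ThinPackings` (`cThesis_of`,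
`ThinPackings_of`, kernel-checked below, through the landed costume theorem `not_thinPackings_iff_not_cThesis`, p76748).
Consequence for route CwPowerHosting: its crux is AT LEAST as strong as the abelian group-theoretic `ω = 2` conjecture
(CKSU 2005 / BCCGNSU 2017 `X_C`); a proof of stmt-0596 (`CAbelianObstructionNeg`) would refute `HostingRateThree`.

WHY IT IS NOT THE DEAD / LIVE LINES.  two-families-salem-spencer: different external heart (stmt-0595, SDPP pairs); the
two hearts are not known to be comparable.  cyclic-carry-charts / truncated-convolution-designs: template + typed
extraction in a product-structured host; here the host is non-product by necessity (product hosts give `4^N`) and the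
template (`xyz` with its UNIQUE tight level structure) is fixed — all difficulty is moved into the HOST, i.e. into
zero-sum additive combinatorics of `N` value pairs (CwPowerHosting's `AdditiveRigidity` + pair systems (†)).  Frames /
log-flat / orbit: no boxes, no multiplicative structure, and the heart is not a relaxation/restriction class of STPP
families (closure test: an arbitrary thin family is not a hosting of `xyz^{⊠N}` — it realises a diagonal of blocks, not the
full support — so no `≡ crux` collapse; conversely the line proves `heart ⇒ crux`, the converse is not claimed).

Disproof used: Disproof.lean (cycles 1–3) has no `_false_without_` theorem; §7 costume theorem USED (composition through
`CThesis`); §3b honoured (witness hosts `H^k` have unbounded size and, for cyclic/mixed `H`, unbounded exponent; for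
elementary-abelian `H` CwPowerHosting's own floors `TwoGroupFloor`/`ThreeGroupFloor` already exclude rate three, matching
Theorem B); no landed Negative lemma concerns hostings.  Negatives index (7): none is an instance.
-/

set_option linter.dupNamespace false

namespace Summit.MatrixMultiplication.MatrixMultiplication.Cruxes.ThinPackings.Cw2FreeHosting

open Finset
open Summit.MatrixMultiplication.MatrixMultiplication.Theses.ThinBlockAlpha (ThinPackings)
open Summit.MatrixMultiplication.MatrixMultiplication.Theses.GroupTheoreticSTPP (CThesis)
open Summit.MatrixMultiplication.MatrixMultiplication.Theses.CwPowerHosting (HostingRateThree)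

/-! ## Definitions -/

/-- The supported LEVEL patterns of `xyz` under the level map `0 ↦ 0`, `1, 2 ↦ 1`: exactly one leg sits at level `0`
(the simple Coppersmith–Winograd support; tight with labels `(-2, 1)` on every leg). -/
def cwLevelSupport : Finset (Fin 2 × Fin 2 × Fin 2) := {(0, 1, 1), (1, 0, 1), (1, 1, 0)}

/-- A finite family of level triples of words of length `M` is SUPPORTED if every coordinate pattern of every member
lies in `cwLevelSupport`. -/
def LevelSupported {M : ℕ} (Δ : Finset ((Fin M → Fin 2) × (Fin M → Fin 2) × (Fin M → Fin 2))) : Prop :=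
  ∀ δ ∈ Δ, ∀ ρ : Fin M, (δ.1 ρ, δ.2.1 ρ, δ.2.2 ρ) ∈ cwLevelSupport

/-- … and a FREE DIAGONAL if the only supported mixture of members is the diagonal one (the tree's notion in
`exists_free_diagonal_jointType_card`; it forces distinct members to have distinct first, second and third words). -/
def LevelFree {M : ℕ} (Δ : Finset ((Fin M → Fin 2) × (Fin M → Fin 2) × (Fin M → Fin 2))) : Prop :=
  ∀ δ ∈ Δ, ∀ δ' ∈ Δ, ∀ δ'' ∈ Δ, (∀ ρ : Fin M, (δ.1 ρ, δ'.2.1 ρ, δ''.2.2 ρ) ∈ cwLevelSupport) → δ = δ' ∧ δ' = δ''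

/-- A free additive hosting of the support of `xyz^{⊠N}` in `H` (the `∃ α β γ` clause of `HostingRateThree`). -/
def IsFreeHosting {N : ℕ} {H : Type} [AddCommGroup H] (α β γ : (Fin N → Fin 3) → H) : Prop :=
  ∀ x y z : Fin N → Fin 3, α x + β y + γ z = 0 ↔ ∀ i, x i ≠ y i ∧ x i ≠ z i ∧ y i ≠ z i

/-! ## Statements of the stubs as named `Prop`s (`Stmt.stub_*`) -/
namespace Stmt

/-- Statement of `stub_freeHosting` (HEART, external = route CwPowerHosting's crux `HostingRateThree`,
stmt-MatrixMultiplication-15970, verbatim by name). -/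
def stub_freeHosting : Prop := HostingRateThree

/-- Statement of `stub_levelDiagonal` (TOOL, M).  **Balanced free diagonals of the simple-CW level structure.**  For
every `ε₂ > 0` and all large `M` divisible by `3` there is a supported free diagonal of level triples of words of length
`M` of size at least `3^M · 2^{-(2/3 + ε₂) M}` (`= (27/4)^{M/3} 2^{-ε₂ M}`; the balanced type has `M/3` coordinates of each
pattern, marginals `(1/3, 2/3)` of entropy `log₂ 3 - 2/3` on every leg).  Proof plan: the tree's PROVED hashing theorem
`Literature.Computability.AlgebraicComplexity.exists_free_diagonal_jointType_card` with `S = cwLevelSupport`, labels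
`α = β = γ = (0 ↦ -2, 1 ↦ 1)` (`r = 1`, `b = 2`), `Q ≡ M/3` on `S`; its `maxEntropyPenalty` vanishes because the three
marginals determine a distribution on `S`, and its sub-exponential loss factor is `≤ 2^{ε₂ M}` for `M ≥ M₀(ε₂)`;
membership in `jointTypeClass` gives `LevelSupported`. -/
def stub_levelDiagonal : Prop :=
  ∀ ε₂ : ℝ, 0 < ε₂ → ∃ M₀ : ℕ, ∀ M : ℕ, M₀ ≤ M → 3 ∣ M →
    ∃ Δ : Finset ((Fin M → Fin 2) × (Fin M → Fin 2) × (Fin M → Fin 2)),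
      LevelSupported Δ ∧ LevelFree Δ ∧ (3 : ℝ) ^ (M : ℝ) * (2 : ℝ) ^ (-((2 / 3 + ε₂) * M)) ≤ Δ.card

/-- Statement of `stub_hostedExtraction` (GLUE, M/L; the line's genuine new lemma).  **A free hosting plus a free level
diagonal is an STPP design.**  Given a free hosting `α β γ` of `xyz^{⊠N}` in `H` and a supported free diagonal `Δ` of level
triples of length `k · N`, the `k`-fold power host `Fin k → H` carries a family of `Δ.card` blocks `(A_δ, B_δ, C_δ)`
satisfying the simultaneous triple product property in the difference form of `CThesis`, each of volume
`|A_δ| |B_δ| |C_δ| = 2^{k N}`.  Proof plan: power the hosting coordinate-blockwise (`Fin (k N) ≃ Fin k × Fin N`); for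
`δ = (I, J, K)` put `X_δ = {x : lev ∘ x = I}` etc.; inside a block the good triples are exactly the matrix-product
incidences `i(x) = i(z)`, `j(x) = j(y)`, `k(y) = k(z)` (`i(x) = x|₁₀₁`, `j(x) = x|₁₁₀`, `j(y) = 3 - y|₁₁₀`, …), so
QUASI-UNIQUENESS (fix `k₀, j₀`: `s_i := γ z(k₀,i)`, `t_j := -β y(j,k₀)`, `u_k := β y(j₀,k) + t_{j₀}`) gives
`α(X_δ) = B_δ - A_δ`, `β(Y_δ) = C_δ - B_δ`, `γ(Z_δ) = A_δ - C_δ` with `|A_δ| = 2^{n₁₀₁}`, `|B_δ| = 2^{n₁₁₀}`,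
`|C_δ| = 2^{n₀₁₁}` (injectivity of `α, β, γ` follows from the hosting's `↔`); a relation
`(s' - s) + (t' - t) + (u' - u) = 0` across blocks `i, j, k` is `α x + β y + γ z = 0` with `x ∈ X_i, y ∈ Y_j, z ∈ Z_k`,
hence good, hence level-supported coordinatewise, hence `i = j = k` by `LevelFree`, and then the incidence pins
`s = s', t = t', u = u'`. -/
def stub_hostedExtraction : Prop :=
  ∀ (N k : ℕ) (H : Type) [AddCommGroup H] [Fintype H] (α β γ : (Fin N → Fin 3) → H),
    IsFreeHosting α β γ →
    ∀ Δ : Finset ((Fin (k * N) → Fin 2) × (Fin (k * N) → Fin 2) × (Fin (k * N) → Fin 2)),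
      LevelSupported Δ → LevelFree Δ →
      ∃ (L : ℕ) (A B C : Fin L → Finset (Fin k → H)), L = Δ.card ∧
        (∀ i j l : Fin L, ∀ s ∈ A l, ∀ s' ∈ A i, ∀ t ∈ B i, ∀ t' ∈ B j, ∀ u ∈ C j, ∀ u' ∈ C l,
          (s' - s) + (t' - t) + (u' - u) = 0 → i = j ∧ j = l ∧ s = s' ∧ t = t' ∧ u = u') ∧
        ∀ i : Fin L, (A i).card * (B i).card * (C i).card = 2 ^ (k * N)

end Stmt

/-! ## Registered stubs -/

/-- HEART (external, open-problem): route CwPowerHosting's crux `HostingRateThree` (stmt-MatrixMultiplication-15970). -/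
theorem stub_freeHosting : Stmt.stub_freeHosting := by
  sorry

/-- TOOL (M): balanced free diagonals of the simple-CW level structure, see `Stmt.stub_levelDiagonal`. -/
theorem stub_levelDiagonal : Stmt.stub_levelDiagonal := by
  sorry

/-- GLUE (M/L): hosting + free level diagonal ⇒ STPP design, see `Stmt.stub_hostedExtraction`. -/
theorem stub_hostedExtraction : Stmt.stub_hostedExtraction := by
  sorry

/-! ## Compositions (kernel-checked, no sorry) -/

/-- Rate bookkeeping: `3^{ε₁ M} < 2^{(ε/6) M}` for `ε₁ = ε/24`, `M > 0`. -/
theorem three_rpow_lt_two_rpow {ε : ℝ} (hε : 0 < ε) {M : ℝ} (hM : 0 < M) :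
    (3 : ℝ) ^ (ε / 24 * M) < (2 : ℝ) ^ (ε / 6 * M) := by
  have h34 : (3 : ℝ) ^ (ε / 24 * M) ≤ (4 : ℝ) ^ (ε / 24 * M) :=
    Real.rpow_le_rpow (by norm_num) (by norm_num) (by positivity)
  have h4 : (4 : ℝ) ^ (ε / 24 * M) = (2 : ℝ) ^ (2 * (ε / 24 * M)) := by
    rw [show (4 : ℝ) = (2 : ℝ) ^ (2 : ℝ) by norm_num, ← Real.rpow_mul (by norm_num)]
  have hlt : (2 : ℝ) ^ (2 * (ε / 24 * M)) < (2 : ℝ) ^ (ε / 6 * M) := by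
    apply Real.rpow_lt_rpow_of_exponent_lt (by norm_num)
    nlinarith
  calc (3 : ℝ) ^ (ε / 24 * M) ≤ (4 : ℝ) ^ (ε / 24 * M) := h34
    _ = (2 : ℝ) ^ (2 * (ε / 24 * M)) := h4
    _ < (2 : ℝ) ^ (ε / 6 * M) := hlt

/-- Heart + diagonal tool + extraction glue ⇒ `CThesis` (stmt-0593), with witnesses in power hosts `Fin k → H`. -/
theorem cThesis_of (hF : Stmt.stub_freeHosting) (hD : Stmt.stub_levelDiagonal) (hE : Stmt.stub_hostedExtraction) :
    CThesis := by
  intro ε hε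
  -- the hosting at rate 3^{1 + ε/24}
  obtain ⟨N, H, instG, instF, hN, hcard, α, β, γ, hhost⟩ := hF (ε / 24) (by positivity)
  -- the free diagonal at loss 2^{-(ε/6) M}
  obtain ⟨M₀, hM₀⟩ := hD (ε / 6) (by positivity)
  set k : ℕ := 3 * (M₀ + 1) with hk
  have hk1 : 1 ≤ k := by omega
  have hMge : M₀ ≤ k * N := by nlinarith
  have hdvd : 3 ∣ k * N := Dvd.dvd.mul_right (Dvd.intro (M₀ + 1) rfl) N
  obtain ⟨Δ, hsupp, hfree, hsize⟩ := hM₀ (k * N) hMge hdvd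
  -- the design
  obtain ⟨L, A, B, C, hL, hS, hvol⟩ := hE N k H α β γ hhost Δ hsupp hfree
  refine ⟨(Fin k → H), inferInstance, inferInstance, L, A, B, C, hS, ?_⟩
  -- bookkeeping
  set M : ℕ := k * N with hMdef
  have hMpos : (0 : ℝ) < (M : ℝ) := by
    have : 0 < M := Nat.mul_pos (by omega) (by omega)
    exact_mod_cast this
  have hvol' : ∀ i : Fin L, (((A i).card * (B i).card * (C i).card : ℕ) : ℝ) = (2 : ℝ) ^ (M : ℝ) := by
    intro i
    rw [hvol i]
    push_cast
    exact (Real.rpow_natCast 2 M).symm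
  have hsum : ∑ i : Fin L, (((A i).card * (B i).card * (C i).card : ℕ) : ℝ) ^ ((2 + ε) / 3) =
      (L : ℝ) * (2 : ℝ) ^ ((M : ℝ) * ((2 + ε) / 3)) := by
    simp_rw [hvol']
    rw [Finset.sum_const, Finset.card_univ, Fintype.card_fin, nsmul_eq_mul, ← Real.rpow_mul (by norm_num)]
  rw [hsum]
  -- |H^k| ≤ 3^{(1 + ε/24) M}
  have hH0 : (0 : ℝ) ≤ (Fintype.card H : ℝ) := by positivity
  have hhost_card : (Fintype.card (Fin k → H) : ℝ) ≤ (3 : ℝ) ^ ((1 + ε / 24) * (M : ℝ)) := by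
    rw [Fintype.card_fun, Fintype.card_fin]
    push_cast
    calc (Fintype.card H : ℝ) ^ k ≤ ((3 : ℝ) ^ ((1 + ε / 24) * (N : ℝ))) ^ k := by
            exact pow_le_pow_left₀ hH0 hcard k
      _ = (3 : ℝ) ^ ((1 + ε / 24) * (N : ℝ) * (k : ℝ)) := by
            rw [← Real.rpow_natCast, ← Real.rpow_mul (by norm_num)]
      _ = (3 : ℝ) ^ ((1 + ε / 24) * (M : ℝ)) := by
            rw [hMdef]; push_cast; ring_nf
  -- |Δ| ≥ 3^M 2^{-(2/3 + ε/6) M}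
  have hLge : (3 : ℝ) ^ (M : ℝ) * (2 : ℝ) ^ (-((2 / 3 + ε / 6) * (M : ℝ))) ≤ (L : ℝ) := by
    rw [hL]; exact hsize
  -- the comparison
  have h3split : (3 : ℝ) ^ ((1 + ε / 24) * (M : ℝ)) = (3 : ℝ) ^ (M : ℝ) * (3 : ℝ) ^ (ε / 24 * (M : ℝ)) := by
    rw [← Real.rpow_add (by norm_num)]; ring_nf
  have hkey : (3 : ℝ) ^ (ε / 24 * (M : ℝ)) < (2 : ℝ) ^ (ε / 6 * (M : ℝ)) := three_rpow_lt_two_rpow hε hMpos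
  have h2split : (2 : ℝ) ^ (-((2 / 3 + ε / 6) * (M : ℝ))) * (2 : ℝ) ^ ((M : ℝ) * ((2 + ε) / 3)) =
      (2 : ℝ) ^ (ε / 6 * (M : ℝ)) := by
    rw [← Real.rpow_add (by norm_num)]; ring_nf
  have h3pos : (0 : ℝ) < (3 : ℝ) ^ (M : ℝ) := by positivity
  have h2pos : (0 : ℝ) < (2 : ℝ) ^ ((M : ℝ) * ((2 + ε) / 3)) := by positivity
  calc (Fintype.card (Fin k → H) : ℝ)
      ≤ (3 : ℝ) ^ ((1 + ε / 24) * (M : ℝ)) := hhost_card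
    _ = (3 : ℝ) ^ (M : ℝ) * (3 : ℝ) ^ (ε / 24 * (M : ℝ)) := h3split
    _ < (3 : ℝ) ^ (M : ℝ) * (2 : ℝ) ^ (ε / 6 * (M : ℝ)) := by
          exact mul_lt_mul_of_pos_left hkey h3pos
    _ = (3 : ℝ) ^ (M : ℝ) * (2 : ℝ) ^ (-((2 / 3 + ε / 6) * (M : ℝ))) * (2 : ℝ) ^ ((M : ℝ) * ((2 + ε) / 3)) := by
          rw [mul_assoc, h2split]
    _ ≤ (L : ℝ) * (2 : ℝ) ^ ((M : ℝ) * ((2 + ε) / 3)) := by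
          exact mul_le_mul_of_nonneg_right hLge h2pos.le

/-- The line concludes the crux BY NAME: heart + tool + glue ⇒ `CThesis` ⇒ `ThinBlockAlpha.ThinPackings` through the
landed costume theorem `not_thinPackings_iff_not_cThesis` (Theorems/ThinPackings/Negative/ThinPackingsIffCThesis.lean,
p76748). -/
theorem ThinPackings_of :
    Stmt.stub_freeHosting → Stmt.stub_levelDiagonal → Stmt.stub_hostedExtraction → ThinPackings := by
  intro hF hD hE
  by_contra h
  exact (Summit.MatrixMultiplication.MatrixMultiplication.Theorems.ThinPackings.Negative.not_thinPackings_iff_not_cThesis.mp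
    h) (cThesis_of hF hD hE)

/-- The crux modulo the registered stubs. -/
theorem ThinPackings_proof : ThinPackings := ThinPackings_of stub_freeHosting stub_levelDiagonal stub_hostedExtraction

/-- BY-PRODUCT for route CwPowerHosting (modulo the two tool/glue stubs, both provable now): its crux implies the
abelian group-theoretic `ω = 2` conjecture `CThesis` (stmt-0593) — so `HostingRateThree` is at least `X_C`-strong and is
refuted by any proof of `CAbelianObstructionNeg` (stmt-0596). -/
theorem hostingRateThree_implies_cThesis (hD : Stmt.stub_levelDiagonal) (hE : Stmt.stub_hostedExtraction) :
    HostingRateThree → CThesis := fun hF => cThesis_of hF hD hE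

end Summit.MatrixMultiplication.MatrixMultiplication.Cruxes.ThinPackings.Cw2FreeHosting
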